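import Summits.Ventures.PercRepro0.EdgeParity

/-!
# Boundary parity: edges leaving a vertex set versus odd-degree vertices inside it (seat p1, gen 1)

Companion of `EdgeParity.lean` (same namespace), Mathlib only. For a finite set `C` of non-diagonal unordered
pairs and a vertex set `S`:

* `oneIn S e` — exactly one endpoint of `e` lies in `S`; `bothIn S e` — both do;
* `sum_edeg_filter`: `Σ_{z ∈ V(C) ∩ S} edeg C z = bdryCount C S + 2·|{e ∈ C : both endpoints in S}|`
  (double counting the incidences between `C` and `S`);
* `even_bdryCount_iff`: the number of edges of `C` with exactly one endpoint in `S` is even iff the number of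
  odd-degree vertices of `C` in `S` is even.

This is the double-counting identity behind P9-separation-p1-v1 Lemma 2.1 (the parity lemma: there `S` is a
half-column) and behind the odd crossing count of a left–right path through a vertical line (`S` a half-plane);
the landed `Parity.even_bdryCount` is the special case of an even edge set. Decidability is classical.
-/

namespace Summit.Ventures.PercRepro0.EdgeParity

open scoped Classical

variable {V : Type*}

/-- `Xor` is symmetric (as a proposition). -/
theorem xor_symm (p q : Prop) : Xor p q = Xor q p := _root_.xor_comm p q

/-- Exactly one endpoint of `e` lies in `S`. -/
def oneIn (S : Set V) (e : Sym2 V) : Prop :=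
  Sym2.lift ⟨fun u v => Xor (u ∈ S) (v ∈ S), fun _ _ => xor_symm _ _⟩ e

/-- Both endpoints of `e` lie in `S`. -/
def bothIn (S : Set V) (e : Sym2 V) : Prop :=
  Sym2.lift ⟨fun u v => u ∈ S ∧ v ∈ S, fun _ _ => propext and_comm⟩ e

/-- `oneIn` on a pair. -/
theorem oneIn_mk (S : Set V) (u v : V) : oneIn S s(u, v) ↔ Xor (u ∈ S) (v ∈ S) := Iff.rfl

/-- `bothIn` on a pair. -/
theorem bothIn_mk (S : Set V) (u v : V) : bothIn S s(u, v) ↔ u ∈ S ∧ v ∈ S := Iff.rfl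

/-- The number of edges of `C` with exactly one endpoint in `S`. -/
noncomputable def bdryCount (C : Finset (Sym2 V)) (S : Set V) : ℕ := (C.filter (oneIn S)).card

variable [DecidableEq V]

/-- The number of endpoints of a non-diagonal pair in `S`: `2·[both] + [exactly one]`. -/
theorem card_endpoints_filter (S : Set V) (e : Sym2 V) (he : ¬ e.IsDiag) :
    ((endpoints e).filter (· ∈ S)).card =
      2 * (if bothIn S e then 1 else 0) + (if oneIn S e then 1 else 0) := by
  induction e using Sym2.ind with
  | h u v =>
    rw [Sym2.mk_isDiag_iff] at he
    rw [endpoints_mk, Finset.filter_insert, Finset.filter_singleton]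
    by_cases hu : u ∈ S <;> by_cases hv : v ∈ S <;>
      simp [hu, hv, bothIn_mk, oneIn_mk, Xor, Finset.card_pair he]

/-- The vertices of `C` (endpoints of its edges) lying in `S`. -/
noncomputable def vertsIn (C : Finset (Sym2 V)) (S : Set V) : Finset V :=
  (C.biUnion endpoints).filter (· ∈ S)

/-- Membership in `vertsIn`. -/
theorem mem_vertsIn (C : Finset (Sym2 V)) (S : Set V) (z : V) :
    z ∈ vertsIn C S ↔ (∃ e ∈ C, z ∈ e) ∧ z ∈ S := by
  simp only [vertsIn, Finset.mem_filter, Finset.mem_biUnion, mem_endpoints]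

/-- **Double counting**: the degrees of the vertices of `C` in `S` sum to the boundary count plus twice the
number of edges inside `S`. -/
theorem sum_edeg_filter (C : Finset (Sym2 V)) (hC : ∀ e ∈ C, ¬ e.IsDiag) (S : Set V) :
    ∑ z ∈ vertsIn C S, edeg C z = bdryCount C S + 2 * (C.filter (bothIn S)).card := by
  simp only [edeg_eq_sum]
  rw [Finset.sum_comm]
  have h : ∀ e ∈ C, (∑ z ∈ vertsIn C S, if z ∈ e then 1 else 0) =
      2 * (if bothIn S e then 1 else 0) + (if oneIn S e then 1 else 0) := by
    intro e he
    rw [← Finset.card_filter, ← card_endpoints_filter S e (hC e he)]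
    congr 1
    ext z
    simp only [Finset.mem_filter, mem_vertsIn, mem_endpoints]
    exact ⟨fun h => ⟨h.2, h.1.2⟩, fun h => ⟨⟨⟨e, he, h.1⟩, h.2⟩, h.1⟩⟩
  rw [Finset.sum_congr rfl h, Finset.sum_add_distrib, ← Finset.mul_sum, bdryCount, Finset.card_filter,
    Finset.card_filter, add_comm]

/-- **Boundary parity**: `C` has an even number of edges with exactly one endpoint in `S` iff `C` has an
even number of odd-degree vertices in `S`. -/
theorem even_bdryCount_iff (C : Finset (Sym2 V)) (hC : ∀ e ∈ C, ¬ e.IsDiag) (S : Set V) :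
    Even (bdryCount C S) ↔ Even ((vertsIn C S).filter fun z => Odd (edeg C z)).card := by
  rw [← Finset.even_sum_iff_even_card_odd, sum_edeg_filter C hC S, Nat.even_add]
  have h2 : Even (2 * (C.filter (bothIn S)).card) := even_two_mul _
  exact ⟨fun h => ⟨fun _ => h2, fun _ => h⟩, fun h => h.2 h2⟩

end Summit.Ventures.PercRepro0.EdgeParity
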